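import Literature.Combinatorics.LorentzianPolynomials.RayleighMultiAffine
import Literature.Combinatorics.LorentzianPolynomials.RayleighSupportIntervalConvex
import HarnessLib

/-!
# Rayleigh measures: convex support, the negative lattice condition (log-submodularity),
# and Rayleigh ⟺ h-NLC+ (Wagner 2008 §4.1; Borcea–Brändén–Liggett 2009 §2.1, Prop. 2.2)

D. G. Wagner, *Negatively correlated random variables and Mason's conjecture for independent sets in matroids*,
Ann. Comb. 12 (2008) 211–239 (arXiv:math/0602648, held `paper:arxiv-math_0602648`), §4.1, for a weight
`ω : 2^E → [0,∞)` whose polynomial `Z(ω; y) = Σ_S ω(S) y^S` "meets the Rayleigh condition"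
(`ΔZ{e,f}(y) = Z_e Z_f - Z_{ef} Z ≥ 0` for `y > 0`, the tree's `IsRayleigh ω`). Verbatim:

> **Lemma 4.1.** Let `𝒬 ⊆ 𝔅(E)` be a (weakly) Rayleigh set–system. (a) For all `g ∈ E`, both `𝒬^g` and `𝒬_g`
> are (weakly) Rayleigh. (b) The dual `𝒬^*` is (weakly) Rayleigh.
> **Theorem 4.2.** Let `𝒬 ⊆ 𝔅(E)` be a weakly Rayleigh set–system. If `{∅, E} ⊆ 𝒬` then `𝒬 = 𝔅(E)`.
> **Corollary 4.3.** Every weakly Rayleigh set–system is convex. [`𝒬` is convex if "for any `S ⊆ T ⊆ S' ⊆ E`, if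
> `S, S' ∈ 𝒬` then `T ∈ 𝒬`".]
> **Theorem 4.4.** If `ω : 𝔅(E) → [0,∞)` is Rayleigh then `ω` is logarithmically submodular: for all
> `S, T ∈ 𝔅(E)`, `ω(S) ω(T) ≥ ω(S ∩ T) ω(S ∪ T)`.
> *Proof.* By the `m = 2` case of the proof of Theorem 4.2, this inequality holds whenever `S ∩ T` is covered by
> both `S` and `T`. It holds trivially if either of `S ∩ T` or `S ∪ T` is not in `Supp(ω)`, so assume otherwise. By
> Corollary 4.3, the interval `[S ∩ T, S ∪ T]` is contained in `Supp(ω)`. Let `S ∩ T = S_0 ⊂ S_1 ⊂ ⋯ ⊂ S_k = S` and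
> `S ∩ T = T_0 ⊂ ⋯ ⊂ T_ℓ = T` be saturated chains […] `ω(S_i ∪ T_{j-1}) ω(S_{i-1} ∪ T_j) ≥ ω(S_{i-1} ∪ T_{j-1})
> ω(S_i ∪ T_j)` […] multiplying all these inequalities together and cancelling […]

J. Borcea, P. Brändén, T. M. Liggett, *Negative dependence and the geometry of polynomials*, J. Amer. Math. Soc.
22 (2009) (arXiv:0707.2340, held), §1–§2.1. Verbatim:

> a polynomial `f ∈ 𝔓_n` satisfies NLC if and only if […] `a_S a_T ≥ a_{S∪T} a_{S∩T}` for all `S, T ⊆ [n]`.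
> (ii) Projections. Given `S ⊆ [n]` and `μ ∈ 𝔓_n` the projection of `μ` onto `2^S` is the measure `μ' ∈ 𝔓_{|S|}`
> with generating polynomial `g_μ(z_1,…,z_n)|_{z_i = 1, i ∈ [n]∖S}`.
> (iv) External fields. […] the measure in `𝔓_n` with generating polynomial `g_μ(a_1z_1,…,a_nz_n)/g_μ(a_1,…,a_n)`.
> **Definition 2.4.** A measure `μ ∈ 𝔓_n` or a polynomial `f ∈ 𝔓_n` satisfies the hereditary negative lattice
> condition or h-NLC if every projection satisfies NLC. One further says that `μ` (respectively, `f`) satisfies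
> the strong hereditary negative lattice condition or h-NLC+ if every measure (respectively, polynomial) obtained
> from `μ` (respectively, `f`) by imposing an external field satisfies h-NLC.
> **Proposition 2.2.** A measure in `𝔓_n` or a polynomial in `𝔓_n` is Rayleigh if and only if it is h-NLC+.
> *Proof.* In [W] it was proved that if `f ∈ 𝔓_n` is Rayleigh then `f` satisfies NLC, which combined with
> Proposition 2.1 shows that `f` is h-NLC+. To prove the converse statement, let `i, j ∈ [n]` with `i ≠ j` and set
> `g(z_i,z_j) = f(z_1,…,z_n)|_{z_k=1, k ∈ [n]∖{i,j}}`. If `f` is h-NLC+ then `g` satisfies NLC […]. In particular,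
> we deduce that `∂_i∂_j f(𝟙) ≤ ∂_i f(𝟙) ∂_j f(𝟙)` […]

## Transposition and route

* Weights `μ : Finset σ → ℝ` (`IsRayleigh`, `derivWeight`, `pin`/`pinIn`/`pinOut`, `extField`, `mass` from the
  sibling files). Wagner's Lemma 4.1 is in the tree: deletion `isRayleigh_pinOut`, contraction
  `isRayleigh_derivWeight` (`RayleighMeasures.lean`), dual `isRayleigh_invWeight` (`WeightInversion.lean`).
* Thm. 4.2 / Cor. 4.3 (`IsRayleigh.pos_of_subset_of_subset`): for a NONNEGATIVE Rayleigh weight the tree's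
  Brändén–Huh bridge `isCRayleigh_one_multiAffine_iff` makes `Σ_S μ(S) z^S` a `1`-Rayleigh polynomial, whose support
  is interval convex by Brändén–Huh Lemma 2.22 (1) (tree `isIntervalConvex_support_of_isCRayleigh`) — the same
  statement as Cor. 4.3 under `S ↦ 1_S`. (Wagner allows "weakly Rayleigh" set systems; for weights this is the
  nonnegative case, which is the one Thm. 4.4 uses.)
* Thm. 4.4 (`IsRayleigh.isNLC`) exactly as printed: the local case ("`S ∩ T` covered by both") is Def. 2.18 at
  `w = 0` (tree `IsCRayleigh.normCoeff_mul_normCoeff_le`), and the chain product is the induction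
  `nlc_of_local_one`/`nlc_of_local` on the two saturated chains, cancelling positive factors supplied by Cor. 4.3.
* BBL: `IsNLC`, the projection `projectOn S μ` (`T ↦ Σ_{U ∩ S = T} μ(U)`, generating polynomial `g_μ|_{z_k = 1,
  k ∉ S}`: `eval_multiAffine_projectOn`), `IsHNLC`, `IsHNLCPlus` (external fields unnormalized — NLC is
  homogeneous, so the normalization `1/g_μ(a)` of (iv) is immaterial), `isRayleigh_projectOn` (projections keep the
  Rayleigh property), and **Prop. 2.2** `isRayleigh_iff_isHNLCPlus` for nonnegative weights, by the printed
  argument: (⇒) Prop. 2.1 + Thm. 4.4; (⇐) NLC of the projection of `g_μ(x·z)` onto `{i,j}` at `S = {i}`, `T = {j}`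
  is `x_i x_j Δ_{ij}(g_μ)(x) ≥ 0`.

## Contents

* §1 square-free exponents: `sum_single_one_le_iff`, `factorialProd_sum_single_one`, `normCoeff_sum_single_one_multiAffine`.
* §2 **Wagner Cor. 4.3 / Thm. 4.2**: `IsRayleigh.pos_of_subset_of_subset`, `IsRayleigh.pos_of_empty_of_univ`.
* §3 **Wagner Thm. 4.4**: `IsNLC`, `IsRayleigh.mul_insert_insert_le` (local case), `IsRayleigh.isNLC`.
* §4 BBL projections: `projectOn`, `eval_multiAffine_projectOn`, `derivWeight_projectOn_of_mem/_of_not_mem`,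
  `isRayleigh_projectOn`.
* §5 **BBL Prop. 2.2**: `IsHNLC`, `IsHNLCPlus`, `IsRayleigh.isHNLCPlus`, `isRayleigh_of_isHNLCPlus`,
  `isRayleigh_iff_isHNLCPlus`.

## References

* [Wagner2008] D. G. Wagner, Negatively correlated random variables and Mason's conjecture for independent sets in
  matroids, Ann. Comb. 12 (2008) 211–239; arXiv:math/0602648 — §4.1 Lemma 4.1, Thm. 4.2, Cor. 4.3, Thm. 4.4.
* [BorceaBrandenLiggett2007] J. Borcea, P. Brändén, T. M. Liggett, Negative dependence and the geometry of
  polynomials, J. Amer. Math. Soc. 22 (2009); arXiv:0707.2340 — §1 (NLC), §2.1 (ii), (iv), Def. 2.4, Def. 2.5,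
  Prop. 2.1, Prop. 2.2.
* [BrandenHuh2019] P. Brändén, J. Huh, Lorentzian polynomials, Ann. of Math. 192 (2020) — §2.4 Def. 2.18,
  Lemma 2.22 (1).
* [Pemantle2000] R. Pemantle, Towards a theory of negative dependence, J. Math. Phys. 41 (2000) — Def. 2.4 (h-NLC).
-/

noncomputable section

open Finset MvPolynomial
open Literature.Combinatorics.Sahi2008
open Literature.Combinatorics.StablePolynomials
open Literature.Combinatorics.LorentzianPolynomials

namespace Literature.Probability.NegativeDependence

variable {σ : Type*} [Fintype σ] [DecidableEq σ]

/-! ## §1 Square-free exponents -/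

section SquareFree

omit [Fintype σ] in
/-- `1_S ≤ 1_T` iff `S ⊆ T` (square-free exponent vectors). [cite: BrandenHuh2019, §2.4 (p. 20, the partial order
on `ℕ^n`)] -/
theorem sum_single_one_le_iff {S T : Finset σ} :
    (∑ i ∈ S, Finsupp.single i 1 : σ →₀ ℕ) ≤ ∑ i ∈ T, Finsupp.single i 1 ↔ S ⊆ T := by
  constructor
  · intro h i hi
    have hi' := h i
    rw [sum_single_one_apply, sum_single_one_apply, if_pos hi] at hi'
    by_contra hiT
    rw [if_neg hiT] at hi'
    exact Nat.not_succ_le_zero 0 hi'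
  · intro h i
    rw [sum_single_one_apply, sum_single_one_apply]
    by_cases hi : i ∈ S
    · rw [if_pos hi, if_pos (h hi)]
    · rw [if_neg hi]; exact Nat.zero_le _

omit [Fintype σ] in
/-- `1_{S ∪ {i}} = 1_S + e_i` for `i ∉ S`. [cite: BrandenHuh2019, §2.4 Def. 2.18 (`α + e_i`)] -/
theorem sum_single_one_insert {S : Finset σ} {i : σ} (hi : i ∉ S) :
    (∑ k ∈ insert i S, Finsupp.single k 1 : σ →₀ ℕ) = (∑ k ∈ S, Finsupp.single k 1) + Finsupp.single i 1 := by
  rw [Finset.sum_insert hi, add_comm]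

/-- `(1_S)! = 1`. [cite: BrandenHuh2019, §2.2 (p. 11, `α!`)] -/
theorem factorialProd_sum_single_one (S : Finset σ) : factorialProd (∑ i ∈ S, Finsupp.single i 1 : σ →₀ ℕ) = 1 := by
  rw [factorialProd]
  refine Finset.prod_eq_one fun i _ => ?_
  rw [sum_single_one_apply]
  split_ifs <;> simp

/-- The normalized coefficient of `z^S` in `Σ_T μ(T) z^T` is `μ(S)`. [cite: BrandenHuh2019, §2.2 (p. 11), §2.4] -/
theorem normCoeff_sum_single_one_multiAffine (μ : Finset σ → ℝ) (S : Finset σ) :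
    normCoeff (∑ i ∈ S, Finsupp.single i 1) (multiAffine μ) = μ S := by
  rw [normCoeff_def, factorialProd_sum_single_one, one_mul, coeff_indicator_multiAffine]

end SquareFree

/-! ## §2 Wagner, Thm. 4.2 and Cor. 4.3: the support of a Rayleigh weight is convex -/

section Support

/-- **Wagner, Corollary 4.3: "Every weakly Rayleigh set–system is convex"** — for a nonnegative Rayleigh weight,
`μ(S) > 0`, `μ(U) > 0` and `S ⊆ T ⊆ U` give `μ(T) > 0`. (Here via Brändén–Huh Lemma 2.22 (1) for the `1`-Rayleigh
polynomial `Σ_S μ(S) z^S`.) [cite: Wagner2008, §4.1 Cor. 4.3; BrandenHuh2019, §2.4 Lemma 2.22 (1)] -/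
theorem IsRayleigh.pos_of_subset_of_subset {μ : Finset σ → ℝ} (h : IsRayleigh μ) (h0 : ∀ S, 0 ≤ μ S)
    {S T U : Finset σ} (hS : 0 < μ S) (hU : 0 < μ U) (hST : S ⊆ T) (hTU : T ⊆ U) : 0 < μ T := by
  have hc : IsCRayleigh 1 (multiAffine μ) := (isCRayleigh_one_multiAffine_iff μ).2 ⟨h0, h⟩
  have key := isIntervalConvex_support_of_isCRayleigh hc
    (α := ∑ i ∈ S, Finsupp.single i 1) (β := ∑ i ∈ U, Finsupp.single i 1) (γ := ∑ i ∈ T, Finsupp.single i 1)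
  simp only [Set.mem_setOf_eq, coeff_indicator_multiAffine] at key
  exact lt_of_le_of_ne (h0 T)
    (Ne.symm (key hS.ne' hU.ne' (sum_single_one_le_iff.2 hST) (sum_single_one_le_iff.2 hTU)))

/-- **Wagner, Theorem 4.2: "If `{∅, E} ⊆ 𝒬` then `𝒬 = 𝔅(E)`"** — a nonnegative Rayleigh weight charging `∅` and the
whole ground set charges every set. [cite: Wagner2008, §4.1 Thm. 4.2] -/
theorem IsRayleigh.pos_of_empty_of_univ {μ : Finset σ → ℝ} (h : IsRayleigh μ) (h0 : ∀ S, 0 ≤ μ S)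
    (he : 0 < μ ∅) (hu : 0 < μ univ) (T : Finset σ) : 0 < μ T :=
  h.pos_of_subset_of_subset h0 he hu (Finset.empty_subset T) (Finset.subset_univ T)

end Support

/-! ## §3 Wagner, Thm. 4.4: Rayleigh weights are logarithmically submodular (NLC) -/

section NLC

omit [Fintype σ] in
/-- **The negative lattice condition** (log-submodularity): `μ(S ∪ T) μ(S ∩ T) ≤ μ(S) μ(T)` for all `S, T`
("`a_S a_T ≥ a_{S∪T} a_{S∩T}` for all `S, T ⊆ [n]`"). [cite: BorceaBrandenLiggett2007, §1 (NLC); Wagner2008,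
§4.1 Thm. 4.4 ("logarithmically submodular")] -/
def IsNLC (μ : Finset σ → ℝ) : Prop := ∀ S T : Finset σ, μ (S ∪ T) * μ (S ∩ T) ≤ μ S * μ T

omit [Fintype σ] in
/-- Unfolding `IsNLC`. [cite: BorceaBrandenLiggett2007, §1 (NLC)] -/
theorem isNLC_iff (μ : Finset σ → ℝ) : IsNLC μ ↔ ∀ S T : Finset σ, μ (S ∪ T) * μ (S ∩ T) ≤ μ S * μ T := Iff.rfl

/-- **The local case of Thm. 4.4** ("the `m = 2` case": `BC ≥ AD`): for a nonnegative Rayleigh weight,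
`μ(U) μ(U ∪ {i,j}) ≤ μ(U ∪ {i}) μ(U ∪ {j})` for `i ≠ j` outside `U` — Def. 2.18 of the `1`-Rayleigh polynomial
`Σ μ(S) z^S` at `w = 0`, `α = 1_U`. [cite: Wagner2008, §4.1 proof of Thm. 4.2 (`m = 2`) and of Thm. 4.4;
BrandenHuh2019, §2.4 Def. 2.18] -/
theorem IsRayleigh.mul_insert_insert_le {μ : Finset σ → ℝ} (h : IsRayleigh μ) (h0 : ∀ S, 0 ≤ μ S)
    {U : Finset σ} {i j : σ} (hij : i ≠ j) (hi : i ∉ U) (hj : j ∉ U) :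
    μ U * μ (insert i (insert j U)) ≤ μ (insert i U) * μ (insert j U) := by
  have hc : IsCRayleigh 1 (multiAffine μ) := (isCRayleigh_one_multiAffine_iff μ).2 ⟨h0, h⟩
  have key := hc.normCoeff_mul_normCoeff_le (∑ k ∈ U, Finsupp.single k 1) i j
  have hj' : j ∉ insert i U := by
    rw [Finset.mem_insert]; exact fun h' => h'.elim (fun h'' => hij (h''.symm)) hj
  rw [← sum_single_one_insert hi, ← sum_single_one_insert hj, ← sum_single_one_insert hj',
    normCoeff_sum_single_one_multiAffine, normCoeff_sum_single_one_multiAffine,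
    normCoeff_sum_single_one_multiAffine, normCoeff_sum_single_one_multiAffine, one_mul, Finset.insert_comm j i U] at key
  exact key

omit [Fintype σ] [DecidableEq σ] in
/-- Cancelling two positive factors between two product inequalities. [folklore] -/
private theorem rls_chain_cancel {a b c d e g : ℝ} (hb : 0 < b) (hd : 0 < d) (hc : 0 ≤ c) (he : 0 ≤ e)
    (h1 : a * b ≤ c * d) (h2 : d * e ≤ b * g) : a * e ≤ c * g := by
  have h3 : a * e * (b * d) ≤ c * g * (b * d) := by
    have := mul_le_mul h1 h2 (mul_nonneg hd.le he) (mul_nonneg hc hd.le)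
    nlinarith [this]
  exact le_of_mul_le_mul_right h3 (mul_pos hb hd)

omit [Fintype σ] in
/-- **One saturated chain** (Thm. 4.4's product along `T_0 ⊂ ⋯ ⊂ T_ℓ` with `k = 1`): local NLC and positivity on
the interval `[A, A ∪ {p} ∪ Q]` give `μ(A) μ(A ∪ {p} ∪ Q) ≤ μ(A ∪ {p}) μ(A ∪ Q)`. [folklore] -/
private theorem rls_nlc_of_local_one {μ : Finset σ → ℝ} (h0 : ∀ S, 0 ≤ μ S) (A : Finset σ) (p : σ) (hp : p ∉ A) :
    ∀ Q : Finset σ, p ∉ Q → Disjoint A Q →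
      (∀ U, A ⊆ U → U ⊆ insert p (A ∪ Q) → 0 < μ U) →
      (∀ U (i j : σ), i ≠ j → i ∉ U → j ∉ U → A ⊆ U → insert i (insert j U) ⊆ insert p (A ∪ Q) →
        μ U * μ (insert i (insert j U)) ≤ μ (insert i U) * μ (insert j U)) →
      μ A * μ (insert p (A ∪ Q)) ≤ μ (insert p A) * μ (A ∪ Q) := by
  intro Q
  induction Q using Finset.induction_on with
  | empty =>
    intro _ _ _ _
    rw [Finset.union_empty]
    try exact le_of_eq (mul_comm _ _)
  | @insert q Q hqQ ih =>
    intro hpQ hAQ hpos hloc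
    rw [Finset.mem_insert, not_or] at hpQ
    rw [Finset.disjoint_insert_right] at hAQ
    have hsub : insert p (A ∪ Q) ⊆ insert p (A ∪ insert q Q) :=
      Finset.insert_subset_insert p (Finset.union_subset_union (Finset.Subset.refl A) (Finset.subset_insert q Q))
    have ih' := ih hpQ.2 hAQ.2 (fun U hAU hU => hpos U hAU (hU.trans hsub))
      (fun U i j hij hiU hjU hAU hU => hloc U i j hij hiU hjU hAU (hU.trans hsub))
    -- the local inequality at `U = A ∪ Q`, `i = p`, `j = q`
    have hpU : p ∉ A ∪ Q := by rw [Finset.mem_union, not_or]; exact ⟨hp, hpQ.2⟩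
    have hqU : q ∉ A ∪ Q := by rw [Finset.mem_union, not_or]; exact ⟨fun h' => hAQ.1 h', hqQ⟩
    have hkey := hloc (A ∪ Q) p q (fun h' => hpQ.1 h') hpU hqU Finset.subset_union_left (by
      rw [Finset.union_insert])
    rw [Finset.union_insert]
    -- cancel `μ(A ∪ Q ∪ {p}) μ(A ∪ Q) > 0`
    have hb : 0 < μ (insert p (A ∪ Q)) := hpos _ (Finset.subset_union_left.trans (Finset.subset_insert _ _)) hsub
    have hd : 0 < μ (A ∪ Q) :=
      hpos _ Finset.subset_union_left ((Finset.subset_insert p _).trans hsub)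
    have h2 : μ (A ∪ Q) * μ (insert p (insert q (A ∪ Q))) ≤ μ (insert p (A ∪ Q)) * μ (insert q (A ∪ Q)) := hkey
    exact rls_chain_cancel hb hd (h0 _) (h0 _) ih' h2

omit [Fintype σ] in
/-- **Both chains** (Thm. 4.4's double product): local NLC and positivity on `[A, A ∪ P ∪ Q]` give
`μ(A) μ(A ∪ P ∪ Q) ≤ μ(A ∪ P) μ(A ∪ Q)`. [folklore] -/
private theorem rls_nlc_of_local {μ : Finset σ → ℝ} (h0 : ∀ S, 0 ≤ μ S) (A Q : Finset σ) (hAQ : Disjoint A Q) :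
    ∀ P : Finset σ, Disjoint A P → Disjoint P Q →
      (∀ U, A ⊆ U → U ⊆ A ∪ P ∪ Q → 0 < μ U) →
      (∀ U (i j : σ), i ≠ j → i ∉ U → j ∉ U → A ⊆ U → insert i (insert j U) ⊆ A ∪ P ∪ Q →
        μ U * μ (insert i (insert j U)) ≤ μ (insert i U) * μ (insert j U)) →
      μ A * μ (A ∪ P ∪ Q) ≤ μ (A ∪ P) * μ (A ∪ Q) := by
  intro P
  induction P using Finset.induction_on with
  | empty =>
    intro _ _ _ _
    rw [Finset.union_empty]
  | @insert p P hpP ih =>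
    intro hAP hPQ hpos hloc
    rw [Finset.disjoint_insert_right] at hAP
    rw [Finset.disjoint_insert_left] at hPQ
    have hsub : A ∪ P ∪ Q ⊆ A ∪ insert p P ∪ Q :=
      Finset.union_subset_union (Finset.union_subset_union (Finset.Subset.refl A) (Finset.subset_insert p P))
        (Finset.Subset.refl Q)
    have ih' := ih hAP.2 hPQ.2 (fun U hAU hU => hpos U hAU (hU.trans hsub))
      (fun U i j hij hiU hjU hAU hU => hloc U i j hij hiU hjU hAU (hU.trans hsub))
    -- one chain above `A ∪ P`
    have hpAP : p ∉ A ∪ P := by rw [Finset.mem_union, not_or]; exact ⟨fun h' => hAP.1 h', hpP⟩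
    have hdis : Disjoint (A ∪ P) Q := Finset.disjoint_union_left.2 ⟨hAQ, hPQ.2⟩
    have heq : insert p (A ∪ P ∪ Q) = A ∪ insert p P ∪ Q := by
      rw [Finset.union_insert, Finset.insert_union]
    have hone := rls_nlc_of_local_one h0 (A ∪ P) p hpAP Q hPQ.1 hdis
      (fun U hAU hU => hpos U (Finset.subset_union_left.trans hAU) (by rw [← heq]; exact hU))
      (fun U i j hij hiU hjU hAU hU => hloc U i j hij hiU hjU (Finset.subset_union_left.trans hAU)
        (by rw [← heq]; exact hU))
    rw [heq, ← Finset.union_insert] at hone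
    -- cancel `μ(A ∪ P) μ(A ∪ P ∪ Q) > 0`
    have hb : 0 < μ (A ∪ P ∪ Q) := hpos _ (Finset.subset_union_left.trans Finset.subset_union_left) hsub
    have hd : 0 < μ (A ∪ P) :=
      hpos _ Finset.subset_union_left (Finset.subset_union_left.trans hsub)
    have h1 : μ A * μ (A ∪ P ∪ Q) ≤ μ (A ∪ Q) * μ (A ∪ P) := by rw [mul_comm (μ (A ∪ Q))]; exact ih'
    have h2 : μ (A ∪ P) * μ (A ∪ insert p P ∪ Q) ≤ μ (A ∪ P ∪ Q) * μ (A ∪ insert p P) := by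
      rw [mul_comm (μ (A ∪ P ∪ Q))]; exact hone
    rw [mul_comm (μ (A ∪ insert p P))]
    exact rls_chain_cancel hb hd (h0 _) (h0 _) h1 h2

/-- **Wagner, Theorem 4.4: "If `ω : 𝔅(E) → [0,∞)` is Rayleigh then `ω` is logarithmically submodular: for all
`S, T ∈ 𝔅(E)`, `ω(S) ω(T) ≥ ω(S ∩ T) ω(S ∪ T)`"** — i.e. Rayleigh measures satisfy NLC ("In [W] it was proved that
if `f ∈ 𝔓_n` is Rayleigh then `f` satisfies NLC"). [cite: Wagner2008, §4.1 Thm. 4.4; BorceaBrandenLiggett2007, §2.1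
proof of Prop. 2.2] -/
theorem IsRayleigh.isNLC {μ : Finset σ → ℝ} (h : IsRayleigh μ) (h0 : ∀ S, 0 ≤ μ S) : IsNLC μ := by
  intro S T
  -- "It holds trivially if either of `S ∩ T` or `S ∪ T` is not in `Supp(ω)`"
  rcases (h0 (S ∩ T)).eq_or_lt with hA | hA
  · rw [← hA, mul_zero]; exact mul_nonneg (h0 S) (h0 T)
  rcases (h0 (S ∪ T)).eq_or_lt with hB | hB
  · rw [← hB, zero_mul]; exact mul_nonneg (h0 S) (h0 T)
  -- the interval `[S ∩ T, S ∪ T]` is in the support (Cor. 4.3); chains from `A = S ∩ T` through `P = S ∖ T`, `Q = T ∖ S`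
  have hdec : S ∩ T ∪ S \ T ∪ T \ S = S ∪ T := by
    ext k
    simp only [Finset.mem_union, Finset.mem_inter, Finset.mem_sdiff]
    tauto
  have hS : S ∩ T ∪ S \ T = S := by
    ext k
    simp only [Finset.mem_union, Finset.mem_inter, Finset.mem_sdiff]
    tauto
  have hT : S ∩ T ∪ T \ S = T := by
    ext k
    simp only [Finset.mem_union, Finset.mem_inter, Finset.mem_sdiff]
    tauto
  have key := rls_nlc_of_local h0 (S ∩ T) (T \ S)
    (Finset.disjoint_left.2 fun k hk hk' => (Finset.mem_sdiff.1 hk').2 (Finset.mem_inter.1 hk).1) (S \ T)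
    (Finset.disjoint_left.2 fun k hk hk' => (Finset.mem_sdiff.1 hk').2 (Finset.mem_inter.1 hk).2)
    (Finset.disjoint_left.2 fun k hk hk' => (Finset.mem_sdiff.1 hk).2 (Finset.mem_sdiff.1 hk').1)
    (fun U hAU hU => h.pos_of_subset_of_subset h0 hA hB hAU (by rw [← hdec]; exact hU))
    (fun U i j hij hiU hjU _ _ => h.mul_insert_insert_le h0 hij hiU hjU)
  rw [hdec, hS, hT] at key
  rw [mul_comm (μ (S ∪ T))]
  exact key

/-- Thm. 4.4 in the local form used most often: `μ(U) μ(U ∪ {i,j}) ≤ μ(U ∪ {i}) μ(U ∪ {j})` with no side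
conditions on `i, j, U`. [cite: Wagner2008, §4.1 Thm. 4.4] -/
theorem IsRayleigh.mul_union_le {μ : Finset σ → ℝ} (h : IsRayleigh μ) (h0 : ∀ S, 0 ≤ μ S) (S T : Finset σ) :
    μ (S ∪ T) * μ (S ∩ T) ≤ μ S * μ T :=
  h.isNLC h0 S T

end NLC

/-! ## §4 Projections (Borcea–Brändén–Liggett §2.1 (ii)) -/

section Projection

/-- **Projection of a weight onto `2^S`** ("the measure with generating polynomial `g_μ|_{z_i = 1, i ∉ S}`"):
`T ↦ Σ_{U : U ∩ S = T} μ(U)` (zero unless `T ⊆ S`; the ambient index type is kept).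
[cite: BorceaBrandenLiggett2007, §2.1 (ii) (Projections)] -/
def projectOn (S : Finset σ) (μ : Finset σ → ℝ) : Finset σ → ℝ := fun T => ∑ U with U ∩ S = T, μ U

/-- Unfolding `projectOn` as a sum with indicator. [cite: BorceaBrandenLiggett2007, §2.1 (ii)] -/
theorem projectOn_apply (S : Finset σ) (μ : Finset σ → ℝ) (T : Finset σ) :
    projectOn S μ T = ∑ U : Finset σ, if U ∩ S = T then μ U else 0 := by
  rw [projectOn, Finset.sum_filter]

/-- Projections of nonnegative weights are nonnegative. [cite: BorceaBrandenLiggett2007, §2.1 (ii)] -/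
theorem projectOn_nonneg {μ : Finset σ → ℝ} (h0 : ∀ U, 0 ≤ μ U) (S T : Finset σ) : 0 ≤ projectOn S μ T := by
  rw [projectOn_apply]
  exact Finset.sum_nonneg fun U _ => by split_ifs <;> simp [h0 U]

/-- A projection is supported on subsets of `S`. [cite: BorceaBrandenLiggett2007, §2.1 (ii)] -/
theorem projectOn_eq_zero_of_not_subset {S T : Finset σ} (μ : Finset σ → ℝ) (hT : ¬ T ⊆ S) : projectOn S μ T = 0 := by
  rw [projectOn_apply]
  refine Finset.sum_eq_zero fun U _ => ?_
  rw [if_neg]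
  intro hU
  exact hT (hU ▸ Finset.inter_subset_right)

/-- **The generating polynomial of the projection is `g_μ|_{z_k = 1, k ∉ S}`.**
[cite: BorceaBrandenLiggett2007, §2.1 (ii) (Projections)] -/
theorem eval_multiAffine_projectOn (S : Finset σ) (μ : Finset σ → ℝ) (x : σ → ℝ) :
    MvPolynomial.eval x (multiAffine (projectOn S μ)) =
      MvPolynomial.eval (fun k => if k ∈ S then x k else 1) (multiAffine μ) := by
  rw [eval_multiAffine, eval_multiAffine]
  simp_rw [projectOn_apply, Finset.sum_mul]
  rw [Finset.sum_comm]
  refine Finset.sum_congr rfl fun U _ => ?_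
  simp_rw [ite_mul, zero_mul]
  rw [Finset.sum_ite_eq Finset.univ (U ∩ S) fun T => μ U * ∏ i ∈ T, x i, if_pos (Finset.mem_univ _)]
  congr 1
  rw [← Finset.prod_filter_mul_prod_filter_not U (fun k => k ∈ S), Finset.filter_mem_eq_inter]
  have h1 : ∏ k ∈ U with k ∉ S, (if k ∈ S then x k else 1) = 1 :=
    Finset.prod_eq_one fun k hk => by rw [if_neg (Finset.mem_filter.1 hk).2]
  rw [h1, mul_one]
  exact Finset.prod_congr rfl fun k hk => by rw [if_pos (Finset.mem_inter.1 hk).2]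

/-- Projection keeps the total mass. [cite: BorceaBrandenLiggett2007, §2.1 (ii)] -/
theorem mass_projectOn (S : Finset σ) (μ : Finset σ → ℝ) : mass (projectOn S μ) = mass μ := by
  have h1 : (fun k => if k ∈ S then (1 : ℝ) else 1) = fun _ => 1 := funext fun k => by split_ifs <;> rfl
  rw [← eval_one_multiAffine, ← eval_one_multiAffine, eval_multiAffine_projectOn, h1]

/-- `∂_k` commutes with projection for `k ∈ S`. [cite: BorceaBrandenLiggett2007, §2.1 (ii), (iii)] -/
theorem derivWeight_projectOn_of_mem {S : Finset σ} {k : σ} (hk : k ∈ S) (μ : Finset σ → ℝ) :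
    derivWeight k (projectOn S μ) = projectOn S (derivWeight k μ) := by
  funext T
  rw [derivWeight_apply, projectOn_apply, projectOn_apply]
  split_ifs with hkT
  · symm
    refine Finset.sum_eq_zero fun U _ => ?_
    split_ifs with hU
    · rw [derivWeight_apply, if_pos]
      rw [← hU] at hkT
      exact (Finset.mem_inter.1 hkT).1
    · rfl
  · -- reindex `U ↦ insert k U` on the sets avoiding `k`
    symm
    rw [← Finset.sum_filter_add_sum_filter_not Finset.univ (fun U : Finset σ => k ∈ U)]
    have h1 : ∑ U ∈ Finset.univ.filter (fun U : Finset σ => k ∈ U),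
        (if U ∩ S = T then derivWeight k μ U else 0) = 0 :=
      Finset.sum_eq_zero fun U hU => by
        rw [derivWeight_apply, if_pos (Finset.mem_filter.1 hU).2]; split_ifs <;> rfl
    rw [h1, zero_add, ← Finset.sum_filter_add_sum_filter_not Finset.univ (fun U : Finset σ => k ∈ U)]
    have h2 : ∑ U ∈ Finset.univ.filter (fun U : Finset σ => ¬ k ∈ U), (if U ∩ S = insert k T then μ U else 0) = 0 :=
      Finset.sum_eq_zero fun U hU => by
        rw [if_neg]
        intro hUS
        exact (Finset.mem_filter.1 hU).2 (Finset.mem_inter.1 (hUS.symm ▸ Finset.mem_insert_self k T)).1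
    rw [h2, add_zero]
    refine Finset.sum_bij' (fun U _ => insert k U) (fun U _ => U.erase k) (fun U hU => ?_) (fun U hU => ?_)
      (fun U hU => ?_) (fun U hU => ?_) (fun U hU => ?_)
    · exact Finset.mem_filter.2 ⟨Finset.mem_univ _, Finset.mem_insert_self k U⟩
    · exact Finset.mem_filter.2 ⟨Finset.mem_univ _, Finset.notMem_erase k U⟩
    · exact Finset.erase_insert (Finset.mem_filter.1 hU).2
    · exact Finset.insert_erase (Finset.mem_filter.1 hU).2
    · have hkU : k ∉ U := (Finset.mem_filter.1 hU).2
      rw [derivWeight_apply, if_neg hkU, Finset.insert_inter_of_mem hk]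
      by_cases hUT : U ∩ S = T
      · rw [if_pos hUT, if_pos (by rw [hUT])]
      · rw [if_neg hUT, if_neg]
        intro h'
        apply hUT
        have := congrArg (fun V => V.erase k) h'
        rwa [Finset.erase_insert (fun h'' => hkU (Finset.mem_inter.1 h'').1), Finset.erase_insert hkT] at this

/-- `∂_k` of a projection vanishes for `k ∉ S`. [cite: BorceaBrandenLiggett2007, §2.1 (ii), (iii)] -/
theorem derivWeight_projectOn_of_not_mem {S : Finset σ} {k : σ} (hk : k ∉ S) (μ : Finset σ → ℝ) :
    derivWeight k (projectOn S μ) = 0 := by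
  funext T
  rw [derivWeight_apply, Pi.zero_apply]
  split_ifs with hkT
  · rfl
  · exact projectOn_eq_zero_of_not_subset μ fun h' => hk (h' (Finset.mem_insert_self k T))

/-- **Projections keep the Rayleigh property** (`Δ_{ij}` of the projection is `Δ_{ij}(g_μ)` at the point with
`x_k = 1` off `S`, or `0`). [cite: BorceaBrandenLiggett2007, §2.1 (ii), Prop. 2.1, proof of Prop. 2.2] -/
theorem isRayleigh_projectOn {μ : Finset σ → ℝ} (h : IsRayleigh μ) (S : Finset σ) : IsRayleigh (projectOn S μ) := by
  rw [isRayleigh_iff]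
  intro x hx i j
  by_cases hi : i ∈ S
  · by_cases hj : j ∈ S
    · simp only [derivWeight_projectOn_of_mem hj, derivWeight_projectOn_of_mem hi, eval_multiAffine_projectOn]
      exact h.le (fun k => by split_ifs; exacts [hx k, one_pos]) i j
    · have hz : multiAffine (0 : Finset σ → ℝ) = 0 := by simp [multiAffine]
      simp only [derivWeight_projectOn_of_not_mem hj, derivWeight_zero, hz, map_zero, zero_mul, mul_zero, le_refl]
  · have hz : multiAffine (0 : Finset σ → ℝ) = 0 := by simp [multiAffine]
    rw [derivWeight_comm]
    simp only [derivWeight_projectOn_of_not_mem hi, derivWeight_zero, hz, map_zero, zero_mul, le_refl]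

end Projection

/-! ## §5 Borcea–Brändén–Liggett, Def. 2.4 and Prop. 2.2: Rayleigh ⟺ h-NLC+ -/

section HNLC

/-- **h-NLC** ("every projection satisfies NLC"). [cite: BorceaBrandenLiggett2007, §2.1 Def. 2.4; Pemantle2000,
Def. 2.4] -/
def IsHNLC (μ : Finset σ → ℝ) : Prop := ∀ S : Finset σ, IsNLC (projectOn S μ)

/-- **h-NLC+** ("every measure obtained from `μ` by imposing an external field satisfies h-NLC"; external fields
`a ∈ ℝ^n_{≥0}`, unnormalized). [cite: BorceaBrandenLiggett2007, §2.1 Def. 2.4, (iv)] -/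
def IsHNLCPlus (μ : Finset σ → ℝ) : Prop := ∀ a : σ → ℝ, (∀ i, 0 ≤ a i) → IsHNLC (extField a μ)

/-- Unfolding `IsHNLC`. [cite: BorceaBrandenLiggett2007, §2.1 Def. 2.4] -/
theorem isHNLC_iff (μ : Finset σ → ℝ) : IsHNLC μ ↔ ∀ S : Finset σ, IsNLC (projectOn S μ) := Iff.rfl

/-- Unfolding `IsHNLCPlus`. [cite: BorceaBrandenLiggett2007, §2.1 Def. 2.4] -/
theorem isHNLCPlus_iff (μ : Finset σ → ℝ) :
    IsHNLCPlus μ ↔ ∀ a : σ → ℝ, (∀ i, 0 ≤ a i) → IsHNLC (extField a μ) := Iff.rfl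

/-- h-NLC gives NLC (project onto everything). [cite: BorceaBrandenLiggett2007, §2.1 Def. 2.4] -/
theorem IsHNLC.isNLC {μ : Finset σ → ℝ} (h : IsHNLC μ) : IsNLC μ := by
  have key := h Finset.univ
  have hid : projectOn Finset.univ μ = μ := by
    funext T
    rw [projectOn_apply]
    simp_rw [Finset.inter_univ]
    rw [Finset.sum_ite_eq' Finset.univ T μ, if_pos (Finset.mem_univ _)]
  rwa [hid] at key

/-- **Prop. 2.2 (⇒): Rayleigh ⟹ h-NLC+** ("[W] … combined with Proposition 2.1": external fields and projections
keep the Rayleigh property, and Rayleigh weights satisfy NLC). [cite: BorceaBrandenLiggett2007, §2.1 Prop. 2.2;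
Wagner2008, §4.1 Thm. 4.4] -/
theorem IsRayleigh.isHNLCPlus {μ : Finset σ → ℝ} (h : IsRayleigh μ) (h0 : ∀ S, 0 ≤ μ S) : IsHNLCPlus μ :=
  fun _ ha S => (isRayleigh_projectOn (isRayleigh_extField h ha) S).isNLC
    (projectOn_nonneg (extField_nonneg h0 ha) S)

/-- The four blocks of `Σ_U μ(U) x^U` according to `U ∩ {i,j}`: the projection of `g_μ(x·z)` onto `{i,j}`.
[cite: BorceaBrandenLiggett2007, §2.1 proof of Prop. 2.2 ("`g(z_i,z_j) = f|_{z_k = 1, k ∉ {i,j}}`")] -/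
theorem projectOn_extField_apply (S : Finset σ) (x : σ → ℝ) (μ : Finset σ → ℝ) (T : Finset σ) :
    projectOn S (extField x μ) T = ∑ U : Finset σ, if U ∩ S = T then μ U * ∏ k ∈ U, x k else 0 := by
  rw [projectOn_apply]
  rfl

/-- **Prop. 2.2 (⇐): h-NLC+ ⟹ Rayleigh** (for `i ≠ j` and `x > 0`, NLC of the projection of `g_μ(x·z)` onto
`{i,j}` at `S = {i}`, `T = {j}` reads `x_i x_j Δ_{ij}(g_μ)(x) ≥ 0`). [cite: BorceaBrandenLiggett2007, §2.1
Prop. 2.2 (proof of the converse)] -/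
theorem isRayleigh_of_isHNLCPlus {μ : Finset σ → ℝ} (h : IsHNLCPlus μ) : IsRayleigh μ := by
  intro x hx i j
  rw [eval_rayleighDiff_multiAffine]
  rcases eq_or_ne i j with rfl | hij
  · rw [derivWeight_derivWeight_self]
    have hz : multiAffine (0 : Finset σ → ℝ) = 0 := by simp [multiAffine]
    rw [hz, map_zero, zero_mul, sub_zero]
    exact mul_self_nonneg _
  -- the NLC inequality of `ν = projectOn {i,j} (extField x μ)` at `{i}`, `{j}`
  have key := h x (fun k => (hx k).le) {i, j} {i} {j}
  rw [← Finset.insert_eq, Finset.singleton_inter_of_notMem (by rwa [Finset.mem_singleton])] at key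
  simp only [projectOn_extField_apply] at key
  -- the four blocks
  set N0 := ∑ U : Finset σ, if U ∩ {i, j} = ∅ then μ U * ∏ k ∈ U, x k else 0 with hN0
  set Ni := ∑ U : Finset σ, if U ∩ {i, j} = {i} then μ U * ∏ k ∈ U, x k else 0 with hNi
  set Nj := ∑ U : Finset σ, if U ∩ {i, j} = {j} then μ U * ∏ k ∈ U, x k else 0 with hNj
  set Nij := ∑ U : Finset σ, if U ∩ {i, j} = {i, j} then μ U * ∏ k ∈ U, x k else 0 with hNij
  -- membership patterns
  have pat : ∀ U : Finset σ,
      (U ∩ {i, j} = ∅ ↔ i ∉ U ∧ j ∉ U) ∧ (U ∩ {i, j} = {i} ↔ i ∈ U ∧ j ∉ U) ∧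
        (U ∩ {i, j} = {j} ↔ i ∉ U ∧ j ∈ U) ∧ (U ∩ {i, j} = {i, j} ↔ i ∈ U ∧ j ∈ U) := by
    intro U
    refine ⟨⟨fun hU => ?_, fun hU => ?_⟩, ⟨fun hU => ?_, fun hU => ?_⟩, ⟨fun hU => ?_, fun hU => ?_⟩,
      ⟨fun hU => ?_, fun hU => ?_⟩⟩
    · constructor
      · intro hi; have : i ∈ U ∩ {i, j} := Finset.mem_inter.2 ⟨hi, by simp⟩; rw [hU] at this; simp at this
      · intro hj; have : j ∈ U ∩ {i, j} := Finset.mem_inter.2 ⟨hj, by simp⟩; rw [hU] at this; simp at this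
    · ext k; simp only [Finset.mem_inter, Finset.mem_insert, Finset.mem_singleton, Finset.notMem_empty, iff_false,
        not_and]; rintro hk (rfl | rfl); exacts [hU.1 hk, hU.2 hk]
    · constructor
      · have : i ∈ U ∩ {i, j} := by rw [hU]; simp
        exact (Finset.mem_inter.1 this).1
      · intro hj; have : j ∈ U ∩ {i, j} := Finset.mem_inter.2 ⟨hj, by simp⟩; rw [hU] at this
        exact hij.symm (Finset.mem_singleton.1 this)
    · ext k; simp only [Finset.mem_inter, Finset.mem_insert, Finset.mem_singleton]
      constructor
      · rintro ⟨hk, rfl | rfl⟩; · rfl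
        · exact absurd hk hU.2
      · rintro rfl; exact ⟨hU.1, Or.inl rfl⟩
    · constructor
      · intro hi; have : i ∈ U ∩ {i, j} := Finset.mem_inter.2 ⟨hi, by simp⟩; rw [hU] at this
        exact hij (Finset.mem_singleton.1 this)
      · have : j ∈ U ∩ {i, j} := by rw [hU]; simp
        exact (Finset.mem_inter.1 this).1
    · ext k; simp only [Finset.mem_inter, Finset.mem_insert, Finset.mem_singleton]
      constructor
      · rintro ⟨hk, rfl | rfl⟩; · exact absurd hk hU.1
        · rfl
      · rintro rfl; exact ⟨hU.2, Or.inr rfl⟩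
    · constructor
      · have : i ∈ U ∩ {i, j} := by rw [hU]; simp
        exact (Finset.mem_inter.1 this).1
      · have : j ∈ U ∩ {i, j} := by rw [hU]; simp
        exact (Finset.mem_inter.1 this).1
    · ext k; simp only [Finset.mem_inter, Finset.mem_insert, Finset.mem_singleton]
      constructor
      · rintro ⟨_, hk⟩; exact hk
      · rintro (rfl | rfl); exacts [⟨hU.1, Or.inl rfl⟩, ⟨hU.2, Or.inr rfl⟩]
  -- the generating-polynomial quantities in terms of the blocks
  have hM : MvPolynomial.eval x (multiAffine μ) = N0 + Ni + Nj + Nij := by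
    rw [eval_multiAffine, hN0, hNi, hNj, hNij, ← Finset.sum_add_distrib, ← Finset.sum_add_distrib,
      ← Finset.sum_add_distrib]
    refine Finset.sum_congr rfl fun U _ => ?_
    simp only [(pat U).1, (pat U).2.1, (pat U).2.2.1, (pat U).2.2.2]
    by_cases hiU : i ∈ U <;> by_cases hjU : j ∈ U <;> simp [hiU, hjU]
  have hBi : MvPolynomial.eval x (multiAffine (pinIn i μ)) = Ni + Nij := by
    rw [eval_multiAffine, hNi, hNij, ← Finset.sum_add_distrib]
    refine Finset.sum_congr rfl fun U _ => ?_
    simp only [pinIn_apply, (pat U).2.1, (pat U).2.2.2]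
    by_cases hiU : i ∈ U <;> by_cases hjU : j ∈ U <;> simp [hiU, hjU]
  have hBj : MvPolynomial.eval x (multiAffine (pinIn j μ)) = Nj + Nij := by
    rw [eval_multiAffine, hNj, hNij, ← Finset.sum_add_distrib]
    refine Finset.sum_congr rfl fun U _ => ?_
    simp only [pinIn_apply, (pat U).2.2.1, (pat U).2.2.2]
    by_cases hiU : i ∈ U <;> by_cases hjU : j ∈ U <;> simp [hiU, hjU]
  have hD : MvPolynomial.eval x (multiAffine (pinIn j (pinIn i μ))) = Nij := by
    rw [eval_multiAffine, hNij]
    refine Finset.sum_congr rfl fun U _ => ?_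
    simp only [pinIn_apply, (pat U).2.2.2]
    by_cases hiU : i ∈ U <;> by_cases hjU : j ∈ U <;> simp [hiU, hjU]
  -- `x_i g_{∂_i μ} = g_{μ|i∈}` etc.
  have e1 : x i * MvPolynomial.eval x (multiAffine (derivWeight i μ)) = Ni + Nij := by
    rw [← eval_multiAffine_pinIn, hBi]
  have e2 : x j * MvPolynomial.eval x (multiAffine (derivWeight j μ)) = Nj + Nij := by
    rw [← eval_multiAffine_pinIn, hBj]
  have e3 : x i * x j * MvPolynomial.eval x (multiAffine (derivWeight i (derivWeight j μ))) = Nij := by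
    rw [mul_comm (x i), mul_assoc, ← eval_multiAffine_pinIn, ← derivWeight_pinIn_of_ne hij.symm,
      ← eval_multiAffine_pinIn, hD]
  -- conclude: `x_i x_j Δ = Ni Nj - Nij N0 ≥ 0`
  have hxij : 0 < x i * x j := mul_pos (hx i) (hx j)
  have goal : 0 ≤ x i * x j * (MvPolynomial.eval x (multiAffine (derivWeight i μ)) *
      MvPolynomial.eval x (multiAffine (derivWeight j μ)) -
      MvPolynomial.eval x (multiAffine (derivWeight i (derivWeight j μ))) * MvPolynomial.eval x (multiAffine μ)) := by
    have : x i * x j * (MvPolynomial.eval x (multiAffine (derivWeight i μ)) *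
        MvPolynomial.eval x (multiAffine (derivWeight j μ)) -
        MvPolynomial.eval x (multiAffine (derivWeight i (derivWeight j μ))) * MvPolynomial.eval x (multiAffine μ)) =
        (x i * MvPolynomial.eval x (multiAffine (derivWeight i μ))) *
          (x j * MvPolynomial.eval x (multiAffine (derivWeight j μ))) -
          (x i * x j * MvPolynomial.eval x (multiAffine (derivWeight i (derivWeight j μ)))) *
            MvPolynomial.eval x (multiAffine μ) := by ring
    rw [this, e1, e2, e3, hM]
    nlinarith [key]
  exact nonneg_of_mul_nonneg_right goal hxij

/-- **Borcea–Brändén–Liggett, Proposition 2.2: "A measure in `𝔓_n` or a polynomial in `𝔓_n` is Rayleigh if and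
only if it is h-NLC+"** (for a nonnegative weight; external fields unnormalized).
[cite: BorceaBrandenLiggett2007, §2.1 Prop. 2.2] -/
theorem isRayleigh_iff_isHNLCPlus {μ : Finset σ → ℝ} (h0 : ∀ S, 0 ≤ μ S) : IsRayleigh μ ↔ IsHNLCPlus μ :=
  ⟨fun h => h.isHNLCPlus h0, isRayleigh_of_isHNLCPlus⟩

/-- In particular a nonnegative Rayleigh weight is h-NLC and NLC. [cite: BorceaBrandenLiggett2007, §2.1
Prop. 2.2; Wagner2008, §4.1 Thm. 4.4] -/
theorem IsRayleigh.isHNLC {μ : Finset σ → ℝ} (h : IsRayleigh μ) (h0 : ∀ S, 0 ≤ μ S) : IsHNLC μ :=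
  fun S => (isRayleigh_projectOn h S).isNLC (projectOn_nonneg h0 S)

end HNLC

end Literature.Probability.NegativeDependence

end
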